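import Mathlib
import Literature.Analysis.PDE.Wave1DDuhamelBound
import Literature.Analysis.PDE.Wave1DFarEnergyLimits
import Literature.Analysis.PDE.Wave1DFarEnergySourced
import Literature.Analysis.Calculus.TwoVariablePartials

/-!
# Duhamel comparison of far channel energies for two nearby potentials

Analysis/PDE support file (everything proved). Let `W, W₀ ≥ 0` be continuous potentials which are
close on `[1, ∞)` in the sense `(W₀ − W)² ≤ κ x^{−5/2} W` and `W₀ ≤ (1 + κ') W` there. Let `ψ` be a
global `C²` function solving `ψ_tt − ψ_xx + Wψ = F` with a continuous source supported in
`{x ≤ 1}` and finite `W`-energy `E` on `(1, ∞)` at `t = 0`, and let `φ` be a global `C²` function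
solving `φ_tt − φ_xx + W₀φ = G` (`G` continuous, supported in `{x ≤ 1}`) with the SAME Cauchy data
at `t = 0`. Then the difference `w = φ − ψ` has zero data and source `−(W₀ − W)ψ` on the far cone,
so by the Duhamel bound on trapezoids (`Wave1DDuhamelBound`) and the decay of the far `W`-energy of
`ψ` (`Wave1DFarEnergyLimits`),

  `∫_{x > 1+|t|} e₀[w](t,·) ≤ 64 κ E`   for every `t`   (`wave1D_farComparison_diff`),

(`∫_0^∞ (1+τ)^{−5/4} dτ = 4`), whence the far channel limits of `φ` (potential `W₀`) are controlled
by those of `ψ` (potential `W`): `L₀⁺ + L₀⁻ ≤ 2(1+κ')(L⁺ + L⁻) + 256 κ E`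
(`wave1D_farComparison_limits`). Perturbative step of the far-side channel estimate of
`FixedModeChannels` (route PhotonSphereChannels, stmt-FinalStateConjecture-10048; `W` the rescaled
Regge–Wheeler potential, `W₀ = n(n+1)ι²`). Folklore (Duhamel; L. C. Evans, *PDE*, §2.4.3).
-/

noncomputable section

namespace Literature.Analysis.PDE

open Set Filter MeasureTheory Literature.Analysis.Calculus
open scoped _root_.Topology

variable {W W₀ : ℝ → ℝ} {F G ψ φ : ℝ → ℝ → ℝ}

/-- The residual `φ_tt − φ_xx + Wφ` of a `C²` function is continuous (local copy of
`FarKernelSpanLemmas.continuous_wave1D_residual`, kept private to decouple build order). [folklore] -/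
private theorem continuous_wave1D_residual_loc (hW : Continuous W)
    (hφ : ContDiff ℝ 2 (Function.uncurry φ)) :
    Continuous (Function.uncurry fun t x =>
      iteratedDeriv 2 (fun τ => φ τ x) t - iteratedDeriv 2 (φ t) x + W x * φ t x) := by
  obtain ⟨-, -, φtt, -, φxx, -, -, hctt, -, hcxx, -, -, -, -, -, -, h7, h8⟩ :=
    exists_partials_of_contDiff_two hφ
  have : (Function.uncurry fun t x =>
      iteratedDeriv 2 (fun τ => φ τ x) t - iteratedDeriv 2 (φ t) x + W x * φ t x)
      = fun p : ℝ × ℝ => φtt p.1 p.2 - φxx p.1 p.2 + W p.2 * φ p.1 p.2 := by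
    funext p; simp only [Function.uncurry, h7, h8]
  rw [this]
  exact (hctt.sub hcxx).add ((hW.comp continuous_snd).mul hφ.continuous)

/-- `∫_0^t (1+τ)^{−5/4} dτ ≤ 4` for `t ≥ 0`. [folklore] -/
theorem integral_one_add_rpow_le (t : ℝ) (ht : 0 ≤ t) :
    ∫ τ in (0 : ℝ)..t, (1 + τ) ^ (-(5 : ℝ) / 4) ≤ 4 := by
  rw [intervalIntegral.integral_comp_add_left (fun x : ℝ => x ^ (-(5 : ℝ) / 4)) 1, add_zero,
    integral_rpow (Or.inr ⟨by norm_num, ?_⟩)]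
  · have h1 : (1 + t) ^ (-(5 : ℝ) / 4 + 1) ≥ 0 := Real.rpow_nonneg (by linarith) _
    have h2 : (1 : ℝ) ^ (-(5 : ℝ) / 4 + 1) = 1 := Real.one_rpow _
    rw [h2]
    have h3 : (-(5 : ℝ) / 4 + 1) = -(1 / 4) := by norm_num
    rw [h3] at h1 ⊢
    have : ((1 + t) ^ (-(1 / 4 : ℝ)) - 1) / (-(1 / 4 : ℝ)) = 4 * (1 - (1 + t) ^ (-(1 / 4 : ℝ))) := by
      ring
    rw [this]; linarith
  · rw [uIcc_of_le (by linarith)]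
    intro h
    exact absurd h.1 (by norm_num)

section Forward

variable (hW : Continuous W) (hW0 : ∀ x, 0 ≤ W x) (hW₀ : Continuous W₀) (hW₀0 : ∀ x, 0 ≤ W₀ x)
  {κ : ℝ} (hκ : 0 ≤ κ)
  (hclose : ∀ x, 1 ≤ x → (W₀ x - W x) ^ 2 ≤ κ * x ^ (-(5 : ℝ) / 2) * W x)
  (hF : Continuous (Function.uncurry F)) (hψ : ContDiff ℝ 2 (Function.uncurry ψ))
  (hψsol : ∀ t x, iteratedDeriv 2 (fun τ => ψ τ x) t - iteratedDeriv 2 (ψ t) x + W x * ψ t x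
    = F t x)
  (hF0 : ∀ τ x, 1 ≤ x → F τ x = 0)
  {E : ℝ} (hEint : IntegrableOn (fun x => deriv (fun τ => ψ τ x) 0 ^ 2 + deriv (ψ 0) x ^ 2
    + W x * ψ 0 x ^ 2) (Ioi 1))
  (hE : ∫ x in Ioi 1, (deriv (fun τ => ψ τ x) 0 ^ 2 + deriv (ψ 0) x ^ 2 + W x * ψ 0 x ^ 2) = E)
  (hφ : ContDiff ℝ 2 (Function.uncurry φ))
  (hφsol : ∀ t x, iteratedDeriv 2 (fun τ => φ τ x) t - iteratedDeriv 2 (φ t) x + W₀ x * φ t x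
    = G t x)
  (hG0 : ∀ τ x, 1 ≤ x → G τ x = 0)
  (hd0 : ∀ x, φ 0 x = ψ 0 x) (hd1 : ∀ x, deriv (fun τ => φ τ x) 0 = deriv (fun τ => ψ τ x) 0)
include hW hW0 hW₀ hW₀0 hκ hclose hF hψ hψsol hF0 hEint hE hφ hφsol hG0 hd0 hd1

/-- **The difference has small far energy, forward in time** (`t ≥ 0`):
`∫_{x>1+t} e₀[φ − ψ](t,·) ≤ 64 κ E`, the density being integrable. [folklore] -/
theorem wave1D_farComparison_diff_nonneg {t : ℝ} (ht : 0 ≤ t) :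
    IntegrableOn (fun x => deriv (fun τ => φ τ x - ψ τ x) t ^ 2
        + deriv (fun y => φ t y - ψ t y) x ^ 2 + W₀ x * (φ t x - ψ t x) ^ 2) (Ioi (1 + t)) ∧
      ∫ x in Ioi (1 + t), (deriv (fun τ => φ τ x - ψ τ x) t ^ 2
        + deriv (fun y => φ t y - ψ t y) x ^ 2 + W₀ x * (φ t x - ψ t x) ^ 2) ≤ 64 * κ * E := by
  set w : ℝ → ℝ → ℝ := fun t x => φ t x - ψ t x with hw
  have hwC : ContDiff ℝ 2 (Function.uncurry w) := hφ.sub hψ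
  set H : ℝ → ℝ → ℝ := fun t x =>
    iteratedDeriv 2 (fun τ => w τ x) t - iteratedDeriv 2 (w t) x + W₀ x * w t x with hH
  have hHc : Continuous (Function.uncurry H) := continuous_wave1D_residual_loc hW₀ hwC
  have hwsol : ∀ t x, iteratedDeriv 2 (fun τ => w τ x) t - iteratedDeriv 2 (w t) x + W₀ x * w t x
      = H t x := fun t x => rfl
  -- on `x ≥ 1` the source is `−(W₀ − W) ψ`
  have hHfar : ∀ t x, 1 ≤ x → H t x = -((W₀ x - W x) * ψ t x) := by
    intro t x hx
    have c1 : ContDiff ℝ 2 fun τ => φ τ x := hφ.comp (contDiff_id.prodMk contDiff_const)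
    have c2 : ContDiff ℝ 2 fun τ => ψ τ x := hψ.comp (contDiff_id.prodMk contDiff_const)
    have c3 : ContDiff ℝ 2 (φ t) := hφ.comp (contDiff_const.prodMk contDiff_id)
    have c4 : ContDiff ℝ 2 (ψ t) := hψ.comp (contDiff_const.prodMk contDiff_id)
    show iteratedDeriv 2 (fun τ => φ τ x - ψ τ x) t - iteratedDeriv 2 (fun y => φ t y - ψ t y) x
        + W₀ x * (φ t x - ψ t x) = -((W₀ x - W x) * ψ t x)
    rw [iteratedDeriv_fun_sub (n := 2) c1.contDiffAt c2.contDiffAt,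
      iteratedDeriv_fun_sub (n := 2) c3.contDiffAt c4.contDiffAt]
    have e1 := hφsol t x
    have e2 := hψsol t x
    rw [hG0 t x hx] at e1
    rw [hF0 t x hx] at e2
    linarith
  have hzero : ∀ b, ∀ x ∈ Ioo 1 b, w 0 x = 0 ∧ deriv (fun τ => w τ x) 0 = 0 := by
    intro b x _
    refine ⟨by simp [hw, hd0 x], ?_⟩
    show deriv (fun τ => φ τ x - ψ τ x) 0 = 0
    have d1 : DifferentiableAt ℝ (fun τ => φ τ x) 0 :=
      ((hφ.comp (contDiff_id.prodMk contDiff_const)).differentiable (by norm_num)) 0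
    have d2 : DifferentiableAt ℝ (fun τ => ψ τ x) 0 :=
      ((hψ.comp (contDiff_id.prodMk contDiff_const)).differentiable (by norm_num)) 0
    rw [deriv_fun_sub d1 d2, hd1 x, sub_self]
  -- the far energy of `ψ` is finite and decays
  have hE0 : 0 ≤ E := by
    rw [← hE]; exact setIntegral_nonneg measurableSet_Ioi fun x _ => wave1D_energyDensity_nonneg hW0 0 x
  have hfinψ : ∫⁻ x in Ioi 1, ENNReal.ofReal (deriv (fun τ => ψ τ x) 0 ^ 2 + deriv (ψ 0) x ^ 2
      + W x * ψ 0 x ^ 2) < ⊤ := by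
    rw [← ofReal_integral_eq_lintegral_ofReal hEint
      (ae_of_all _ fun x => wave1D_energyDensity_nonneg hW0 0 x)]
    exact ENNReal.ofReal_lt_top
  have hψfar : ∀ τ, 0 ≤ τ → IntegrableOn (fun x => deriv (fun σ => ψ σ x) τ ^ 2 + deriv (ψ τ) x ^ 2
        + W x * ψ τ x ^ 2) (Ioi (1 + τ)) ∧
      ∫ x in Ioi (1 + τ), (deriv (fun σ => ψ σ x) τ ^ 2 + deriv (ψ τ) x ^ 2 + W x * ψ τ x ^ 2)
        ≤ E := by
    intro τ hτ
    have h1 := (wave1D_farEnergy_integrableOn hW hW0 hF hψ hψsol (c := 1) hF0 hfinψ τ).1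
    have h2 := wave1D_farEnergy_real_mono_nonneg hW hW0 hF hψ hψsol (c := 1) hF0 hfinψ le_rfl hτ
    rw [abs_of_nonneg hτ] at h1 h2
    simp only [abs_zero, add_zero] at h2
    exact ⟨h1, hE ▸ h2⟩
  -- the source bound on slices: `∫_{1+τ}^{b−τ} H² ≤ κ (1+τ)^{-5/2} E`
  have hslice : ∀ τ, 0 ≤ τ → ∀ b, ∫ x in (1 + τ)..(b - τ), H τ x ^ 2
      ≤ κ * (1 + τ) ^ (-(5 : ℝ) / 2) * E := by
    intro τ hτ b
    rcases le_or_gt (b - τ) (1 + τ) with hb | hb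
    · rw [intervalIntegral.integral_of_ge hb]
      have : 0 ≤ ∫ x in Ioc (b - τ) (1 + τ), H τ x ^ 2 :=
        setIntegral_nonneg measurableSet_Ioc fun x _ => sq_nonneg _
      linarith [(by positivity : 0 ≤ κ * (1 + τ) ^ (-(5 : ℝ) / 2) * E)]
    · obtain ⟨hint, hle⟩ := hψfar τ hτ
      have hτ1 : 0 < 1 + τ := by linarith
      -- pointwise on `(1+τ, b−τ]`
      have hpt : ∀ x ∈ Ioc (1 + τ) (b - τ), H τ x ^ 2
          ≤ κ * (1 + τ) ^ (-(5 : ℝ) / 2) * (deriv (fun σ => ψ σ x) τ ^ 2 + deriv (ψ τ) x ^ 2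
            + W x * ψ τ x ^ 2) := by
        intro x hx
        have hx1 : 1 ≤ x := by linarith [hx.1]
        rw [hHfar τ x hx1, neg_sq, mul_pow]
        have hc := hclose x hx1
        have hxpow : x ^ (-(5 : ℝ) / 2) ≤ (1 + τ) ^ (-(5 : ℝ) / 2) :=
          Real.rpow_le_rpow_of_nonpos hτ1 hx.1.le (by norm_num)
        have hWx := hW0 x
        have hrest : 0 ≤ deriv (fun σ => ψ σ x) τ ^ 2 + deriv (ψ τ) x ^ 2 := by positivity
        calc (W₀ x - W x) ^ 2 * ψ τ x ^ 2 ≤ κ * x ^ (-(5 : ℝ) / 2) * W x * ψ τ x ^ 2 :=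
              mul_le_mul_of_nonneg_right hc (sq_nonneg _)
          _ ≤ κ * (1 + τ) ^ (-(5 : ℝ) / 2) * W x * ψ τ x ^ 2 := by
              have : 0 ≤ W x * ψ τ x ^ 2 := by positivity
              have := mul_le_mul_of_nonneg_left hxpow hκ
              nlinarith
          _ ≤ κ * (1 + τ) ^ (-(5 : ℝ) / 2) * (deriv (fun σ => ψ σ x) τ ^ 2 + deriv (ψ τ) x ^ 2
              + W x * ψ τ x ^ 2) := by
              have hk : 0 ≤ κ * (1 + τ) ^ (-(5 : ℝ) / 2) := by positivity
              nlinarith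
      rw [intervalIntegral.integral_of_le hb.le]
      have hsub : Ioc (1 + τ) (b - τ) ⊆ Ioi (1 + τ) := Ioc_subset_Ioi_self
      calc ∫ x in Ioc (1 + τ) (b - τ), H τ x ^ 2
          ≤ ∫ x in Ioc (1 + τ) (b - τ), κ * (1 + τ) ^ (-(5 : ℝ) / 2)
              * (deriv (fun σ => ψ σ x) τ ^ 2 + deriv (ψ τ) x ^ 2 + W x * ψ τ x ^ 2) :=
            setIntegral_mono_on ((hHc.comp (continuous_const.prodMk continuous_id)).pow 2
              |>.integrableOn_Icc.mono_set Ioc_subset_Icc_self)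
              ((hint.mono_set hsub).const_mul _) measurableSet_Ioc hpt
        _ = κ * (1 + τ) ^ (-(5 : ℝ) / 2) * ∫ x in Ioc (1 + τ) (b - τ),
              (deriv (fun σ => ψ σ x) τ ^ 2 + deriv (ψ τ) x ^ 2 + W x * ψ τ x ^ 2) :=
            MeasureTheory.integral_const_mul _ _
        _ ≤ κ * (1 + τ) ^ (-(5 : ℝ) / 2) * E := by
            refine mul_le_mul_of_nonneg_left ?_ (by positivity)
            exact (setIntegral_mono_set hint (ae_of_all _ fun x => wave1D_energyDensity_nonneg hW0 τ x)
              (ae_of_all _ hsub)).trans hle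
  -- Duhamel on trapezoids over `(1, b)`, then `b → ∞`
  have htrap : ∀ b, 1 + t ≤ b - t → ∫ x in (1 + t)..(b - t), (deriv (fun τ => w τ x) t ^ 2
      + deriv (w t) x ^ 2 + W₀ x * w t x ^ 2) ≤ 64 * κ * E := by
    intro b hb
    have hD := wave1D_trapezoid_energy_le_of_zero_data hW₀ hW₀0 hHc hwC hwsol (hzero b) ht hb
    refine hD.trans ?_
    -- `∫_0^t √(∫ H²) ≤ 4 √κ √E`
    have hI : ∫ τ in (0 : ℝ)..t, Real.sqrt (∫ x in (1 + τ)..(b - τ), H τ x ^ 2)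
        ≤ 4 * (Real.sqrt κ * Real.sqrt E) := by
      have hle : ∀ τ ∈ Icc 0 t, Real.sqrt (∫ x in (1 + τ)..(b - τ), H τ x ^ 2)
          ≤ Real.sqrt κ * Real.sqrt E * (1 + τ) ^ (-(5 : ℝ) / 4) := by
        intro τ hτ
        have h1 := hslice τ hτ.1 b
        have hτ1 : 0 < 1 + τ := by linarith [hτ.1]
        have e : κ * (1 + τ) ^ (-(5 : ℝ) / 2) * E
            = (Real.sqrt κ * Real.sqrt E * (1 + τ) ^ (-(5 : ℝ) / 4)) ^ 2 := by
          rw [mul_pow, mul_pow, Real.sq_sqrt hκ, Real.sq_sqrt hE0, ← Real.rpow_natCast,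
            ← Real.rpow_mul hτ1.le]
          norm_num; ring
        rw [e] at h1
        exact Real.sqrt_le_sqrt h1 |>.trans (le_of_eq (Real.sqrt_sq (by positivity)))
      rw [intervalIntegral.integral_of_le ht]
      have hg : IntegrableOn (fun τ => Real.sqrt κ * Real.sqrt E * (1 + τ) ^ (-(5 : ℝ) / 4))
          (Ioc 0 t) := by
        refine (ContinuousOn.integrableOn_Icc ?_).mono_set Ioc_subset_Icc_self
        exact continuousOn_const.mul (ContinuousOn.rpow_const (continuousOn_const.add continuousOn_id)
          fun x hx => Or.inl (by have : (0:ℝ) ≤ x := hx.1; linarith))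
      calc ∫ τ in Ioc 0 t, Real.sqrt (∫ x in (1 + τ)..(b - τ), H τ x ^ 2)
          ≤ ∫ τ in Ioc 0 t, Real.sqrt κ * Real.sqrt E * (1 + τ) ^ (-(5 : ℝ) / 4) :=
            integral_mono_of_nonneg (ae_of_all _ fun τ => Real.sqrt_nonneg _) hg
              ((ae_restrict_iff' measurableSet_Ioc).2 (ae_of_all _ fun τ hτ =>
                hle τ (Ioc_subset_Icc_self hτ)))
        _ = Real.sqrt κ * Real.sqrt E * ∫ τ in (0 : ℝ)..t, (1 + τ) ^ (-(5 : ℝ) / 4) := by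
            rw [MeasureTheory.integral_const_mul, intervalIntegral.integral_of_le ht]
        _ ≤ Real.sqrt κ * Real.sqrt E * 4 :=
            mul_le_mul_of_nonneg_left (integral_one_add_rpow_le t ht) (by positivity)
        _ = 4 * (Real.sqrt κ * Real.sqrt E) := by ring
    have h0 : 0 ≤ ∫ τ in (0 : ℝ)..t, Real.sqrt (∫ x in (1 + τ)..(b - τ), H τ x ^ 2) :=
      intervalIntegral.integral_nonneg ht fun τ _ => Real.sqrt_nonneg _
    calc 4 * (∫ τ in (0 : ℝ)..t, Real.sqrt (∫ x in (1 + τ)..(b - τ), H τ x ^ 2)) ^ 2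
        ≤ 4 * (4 * (Real.sqrt κ * Real.sqrt E)) ^ 2 := by gcongr
      _ = 64 * κ * E := by
          rw [mul_pow, mul_pow, Real.sq_sqrt hκ, Real.sq_sqrt hE0]; ring
  -- `b → ∞`
  set dens : ℝ → ℝ := fun x => deriv (fun τ => w τ x) t ^ 2 + deriv (w t) x ^ 2 + W₀ x * w t x ^ 2
    with hdens
  have hdens_c : Continuous dens :=
    (continuous_wave1D_energyDensity hW₀ hwC).comp (continuous_const.prodMk continuous_id)
  have hdens_nn : ∀ x, 0 ≤ dens x := fun x => wave1D_energyDensity_nonneg hW₀0 t x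
  have hbound : ∀ X, 1 + 2 * t ≤ X → ∫ x in (1 + t)..X, dens x ≤ 64 * κ * E := by
    intro X hX
    have := htrap (X + t) (by linarith)
    rw [show X + t - t = X by ring] at this
    exact this
  have hint : IntegrableOn dens (Ioi (1 + t)) := by
    refine integrableOn_Ioi_of_intervalIntegral_norm_bounded (64 * κ * E) (1 + t)
      (l := atTop) (b := id) (fun X => (hdens_c.integrableOn_Icc).mono_set Ioc_subset_Icc_self)
      tendsto_id ?_
    filter_upwards [eventually_ge_atTop (1 + 2 * t)] with X hX
    have : ∫ x in (1 + t)..id X, ‖dens x‖ = ∫ x in (1 + t)..X, dens x :=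
      intervalIntegral.integral_congr fun x _ => by rw [Real.norm_eq_abs, abs_of_nonneg (hdens_nn x)]
    rw [this]; exact hbound X hX
  have hlim : Tendsto (fun X => ∫ x in (1 + t)..X, dens x) atTop (𝓝 (∫ x in Ioi (1 + t), dens x)) :=
    intervalIntegral_tendsto_integral_Ioi (1 + t) hint tendsto_id
  exact ⟨hint, le_of_tendsto hlim ((eventually_ge_atTop (1 + 2 * t)).mono fun X hX => hbound X hX)⟩

/-- **The difference has small far energy, both time directions.** For every `t`:
`∫_{x>1+|t|} e₀[φ − ψ](t,·) ≤ 64 κ E` (density integrable). [folklore] -/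
theorem wave1D_farComparison_diff (t : ℝ) :
    IntegrableOn (fun x => deriv (fun τ => φ τ x - ψ τ x) t ^ 2
        + deriv (fun y => φ t y - ψ t y) x ^ 2 + W₀ x * (φ t x - ψ t x) ^ 2) (Ioi (1 + |t|)) ∧
      ∫ x in Ioi (1 + |t|), (deriv (fun τ => φ τ x - ψ τ x) t ^ 2
        + deriv (fun y => φ t y - ψ t y) x ^ 2 + W₀ x * (φ t x - ψ t x) ^ 2) ≤ 64 * κ * E := by
  rcases le_total 0 t with ht | ht
  · rw [abs_of_nonneg ht]
    exact wave1D_farComparison_diff_nonneg hW hW0 hW₀ hW₀0 hκ hclose hF hψ hψsol hF0 hEint hE hφ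
      hφsol hG0 hd0 hd1 ht
  · -- time reversal
    obtain ⟨hψrC, hψrsol, hψre⟩ := wave1D_timeReversal_source hψ hψsol
    obtain ⟨hφrC, hφrsol, -⟩ := wave1D_timeReversal_source hφ hφsol
    have hFr : Continuous (Function.uncurry fun t x => F (-t) x) :=
      hF.comp (continuous_fst.neg.prodMk continuous_snd)
    have hd1r : ∀ x, deriv (fun τ => (fun t x => φ (-t) x) τ x) 0
        = deriv (fun τ => (fun t x => ψ (-t) x) τ x) 0 := by
      intro x
      show deriv (fun τ => φ (-τ) x) 0 = deriv (fun τ => ψ (-τ) x) 0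
      rw [deriv_comp_neg (fun τ => φ τ x) 0, deriv_comp_neg (fun τ => ψ τ x) 0, neg_zero, hd1 x]
    have hEintr : IntegrableOn (fun x => deriv (fun τ => (fun t x => ψ (-t) x) τ x) 0 ^ 2
        + deriv ((fun t x => ψ (-t) x) 0) x ^ 2 + W x * (fun t x => ψ (-t) x) 0 x ^ 2) (Ioi 1) := by
      refine hEint.congr_fun (fun x _ => ?_) measurableSet_Ioi
      simp only [hψre, neg_zero]
    have hEr : ∫ x in Ioi 1, (deriv (fun τ => (fun t x => ψ (-t) x) τ x) 0 ^ 2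
        + deriv ((fun t x => ψ (-t) x) 0) x ^ 2 + W x * (fun t x => ψ (-t) x) 0 x ^ 2) = E := by
      rw [← hE]
      refine setIntegral_congr_fun measurableSet_Ioi fun x _ => ?_
      simp only [hψre, neg_zero]
    have hs : 0 ≤ -t := by linarith
    have h := wave1D_farComparison_diff_nonneg hW hW0 hW₀ hW₀0 hκ hclose hFr hψrC hψrsol
      (fun τ x hx => hF0 (-τ) x hx) hEintr hEr hφrC hφrsol (fun τ x hx => hG0 (-τ) x hx)
      (fun x => by simp only [neg_zero]; exact hd0 x) hd1r hs
    -- identify the reversed density at time `-t` with the density at time `t`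
    have hid : ∀ x, deriv (fun τ => (fun t x => φ (-t) x) τ x - (fun t x => ψ (-t) x) τ x) (-t) ^ 2
          + deriv (fun y => (fun t x => φ (-t) x) (-t) y - (fun t x => ψ (-t) x) (-t) y) x ^ 2
          + W₀ x * ((fun t x => φ (-t) x) (-t) x - (fun t x => ψ (-t) x) (-t) x) ^ 2
        = deriv (fun τ => φ τ x - ψ τ x) t ^ 2
          + deriv (fun y => φ t y - ψ t y) x ^ 2 + W₀ x * (φ t x - ψ t x) ^ 2 := by
      intro x
      have e1 : deriv (fun τ => φ (-τ) x - ψ (-τ) x) (-t) = -deriv (fun τ => φ τ x - ψ τ x) t := by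
        rw [show (fun τ => φ (-τ) x - ψ (-τ) x) = fun τ => (fun σ => φ σ x - ψ σ x) (-τ) from rfl,
          deriv_comp_neg (fun σ => φ σ x - ψ σ x) (-t), neg_neg]
      simp only [neg_neg, e1, even_two.neg_pow]
    rw [abs_of_nonpos ht]
    refine ⟨(h.1.congr_fun (fun x _ => hid x) measurableSet_Ioi), ?_⟩
    rw [← setIntegral_congr_fun measurableSet_Ioi (fun x _ => hid x)]
    exact h.2

/-- **Comparison of the far channel limits.** If moreover `W₀ ≤ (1+κ')W` on `[1,∞)` then the far
channel limits `L₀±` of `φ` (potential `W₀`) and `L±` of `ψ` (potential `W`) satisfy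
`L₀⁺ + L₀⁻ ≤ 2(1+κ')(L⁺ + L⁻) + 256 κ E`. [folklore] -/
theorem wave1D_farComparison_limits {κ' : ℝ} (hκ' : 0 ≤ κ')
    (hdom : ∀ x, 1 ≤ x → W₀ x ≤ (1 + κ') * W x) {Lp Lm Lp₀ Lm₀ : ℝ}
    (hLp : Tendsto (fun t => ∫ x in Ioi (1 + |t|), (deriv (fun τ => ψ τ x) t ^ 2
      + deriv (ψ t) x ^ 2 + W x * ψ t x ^ 2)) atTop (𝓝 Lp))
    (hLm : Tendsto (fun t => ∫ x in Ioi (1 + |t|), (deriv (fun τ => ψ τ x) t ^ 2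
      + deriv (ψ t) x ^ 2 + W x * ψ t x ^ 2)) atBot (𝓝 Lm))
    (hLp₀ : Tendsto (fun t => ∫ x in Ioi (1 + |t|), (deriv (fun τ => φ τ x) t ^ 2
      + deriv (φ t) x ^ 2 + W₀ x * φ t x ^ 2)) atTop (𝓝 Lp₀))
    (hLm₀ : Tendsto (fun t => ∫ x in Ioi (1 + |t|), (deriv (fun τ => φ τ x) t ^ 2
      + deriv (φ t) x ^ 2 + W₀ x * φ t x ^ 2)) atBot (𝓝 Lm₀)) :
    Lp₀ + Lm₀ ≤ 2 * (1 + κ') * (Lp + Lm) + 256 * κ * E := by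
  -- finiteness of the far `W`-energy of `ψ`
  have hfinψ : ∫⁻ x in Ioi 1, ENNReal.ofReal (deriv (fun τ => ψ τ x) 0 ^ 2 + deriv (ψ 0) x ^ 2
      + W x * ψ 0 x ^ 2) < ⊤ := by
    rw [← ofReal_integral_eq_lintegral_ofReal hEint
      (ae_of_all _ fun x => wave1D_energyDensity_nonneg hW0 0 x)]
    exact ENNReal.ofReal_lt_top
  -- pointwise comparison at every time
  have hpt : ∀ t, (∫ x in Ioi (1 + |t|), (deriv (fun τ => φ τ x) t ^ 2 + deriv (φ t) x ^ 2
      + W₀ x * φ t x ^ 2))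
      ≤ 2 * (1 + κ') * (∫ x in Ioi (1 + |t|), (deriv (fun τ => ψ τ x) t ^ 2 + deriv (ψ t) x ^ 2
        + W x * ψ t x ^ 2)) + 128 * κ * E := by
    intro t
    obtain ⟨hwint, hwle⟩ := wave1D_farComparison_diff hW hW0 hW₀ hW₀0 hκ hclose hF hψ hψsol hF0
      hEint hE hφ hφsol hG0 hd0 hd1 t
    have hψint := (wave1D_farEnergy_integrableOn hW hW0 hF hψ hψsol (c := 1) hF0 hfinψ t).1
    -- pointwise density inequality on `Ioi (1+|t|)`
    have hdens : ∀ x ∈ Ioi (1 + |t|), deriv (fun τ => φ τ x) t ^ 2 + deriv (φ t) x ^ 2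
        + W₀ x * φ t x ^ 2
        ≤ 2 * (1 + κ') * (deriv (fun τ => ψ τ x) t ^ 2 + deriv (ψ t) x ^ 2 + W x * ψ t x ^ 2)
          + 2 * (deriv (fun τ => φ τ x - ψ τ x) t ^ 2 + deriv (fun y => φ t y - ψ t y) x ^ 2
            + W₀ x * (φ t x - ψ t x) ^ 2) := by
      intro x hx
      have hx1 : 1 ≤ x := by have : 1 + |t| < x := hx; linarith [abs_nonneg t]
      have d1 : DifferentiableAt ℝ (fun τ => φ τ x) t :=
        ((hφ.comp (contDiff_id.prodMk contDiff_const)).differentiable (by norm_num)) t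
      have d2 : DifferentiableAt ℝ (fun τ => ψ τ x) t :=
        ((hψ.comp (contDiff_id.prodMk contDiff_const)).differentiable (by norm_num)) t
      have d3 : DifferentiableAt ℝ (φ t) x :=
        ((hφ.comp (contDiff_const.prodMk contDiff_id)).differentiable (by norm_num)) x
      have d4 : DifferentiableAt ℝ (ψ t) x :=
        ((hψ.comp (contDiff_const.prodMk contDiff_id)).differentiable (by norm_num)) x
      rw [deriv_fun_sub d1 d2, show (fun y => φ t y - ψ t y) = fun y => φ t y - ψ t y from rfl,
        deriv_fun_sub d3 d4]
      set a := deriv (fun τ => φ τ x) t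
      set b := deriv (fun τ => ψ τ x) t
      set c := deriv (φ t) x
      set d := deriv (ψ t) x
      have hW0x := hW0 x; have hW₀x := hW₀0 x; have hdomx := hdom x hx1
      have i1 : a ^ 2 ≤ 2 * b ^ 2 + 2 * (a - b) ^ 2 := by nlinarith [sq_nonneg (a - 2 * b)]
      have i2 : c ^ 2 ≤ 2 * d ^ 2 + 2 * (c - d) ^ 2 := by nlinarith [sq_nonneg (c - 2 * d)]
      have i3 : φ t x ^ 2 ≤ 2 * ψ t x ^ 2 + 2 * (φ t x - ψ t x) ^ 2 := by
        nlinarith [sq_nonneg (φ t x - 2 * ψ t x)]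
      have i4 : W₀ x * φ t x ^ 2 ≤ 2 * ((1 + κ') * W x) * ψ t x ^ 2 + 2 * W₀ x * (φ t x - ψ t x) ^ 2 := by
        have := mul_le_mul_of_nonneg_left i3 hW₀x
        have h2 : W₀ x * ψ t x ^ 2 ≤ (1 + κ') * W x * ψ t x ^ 2 :=
          mul_le_mul_of_nonneg_right hdomx (sq_nonneg _)
        nlinarith
      have i5 : 2 * b ^ 2 + 2 * d ^ 2 ≤ 2 * (1 + κ') * (b ^ 2 + d ^ 2) := by
        nlinarith [sq_nonneg b, sq_nonneg d]
      nlinarith [i1, i2, i4, i5, sq_nonneg (a - b), sq_nonneg (c - d)]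
    have hg : IntegrableOn (fun x => 2 * (1 + κ') * (deriv (fun τ => ψ τ x) t ^ 2 + deriv (ψ t) x ^ 2
        + W x * ψ t x ^ 2) + 2 * (deriv (fun τ => φ τ x - ψ τ x) t ^ 2
          + deriv (fun y => φ t y - ψ t y) x ^ 2 + W₀ x * (φ t x - ψ t x) ^ 2)) (Ioi (1 + |t|)) :=
      (hψint.const_mul _).add (hwint.const_mul _)
    calc (∫ x in Ioi (1 + |t|), (deriv (fun τ => φ τ x) t ^ 2 + deriv (φ t) x ^ 2
          + W₀ x * φ t x ^ 2))
        ≤ ∫ x in Ioi (1 + |t|), (2 * (1 + κ') * (deriv (fun τ => ψ τ x) t ^ 2 + deriv (ψ t) x ^ 2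
            + W x * ψ t x ^ 2) + 2 * (deriv (fun τ => φ τ x - ψ τ x) t ^ 2
            + deriv (fun y => φ t y - ψ t y) x ^ 2 + W₀ x * (φ t x - ψ t x) ^ 2)) :=
          integral_mono_of_nonneg (ae_of_all _ fun x => wave1D_energyDensity_nonneg hW₀0 t x) hg
            ((ae_restrict_iff' measurableSet_Ioi).2 (ae_of_all _ hdens))
      _ = 2 * (1 + κ') * (∫ x in Ioi (1 + |t|), (deriv (fun τ => ψ τ x) t ^ 2 + deriv (ψ t) x ^ 2
            + W x * ψ t x ^ 2)) + 2 * ∫ x in Ioi (1 + |t|), (deriv (fun τ => φ τ x - ψ τ x) t ^ 2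
            + deriv (fun y => φ t y - ψ t y) x ^ 2 + W₀ x * (φ t x - ψ t x) ^ 2) := by
          rw [integral_add (hψint.const_mul _) (hwint.const_mul _),
            MeasureTheory.integral_const_mul, MeasureTheory.integral_const_mul]
      _ ≤ 2 * (1 + κ') * (∫ x in Ioi (1 + |t|), (deriv (fun τ => ψ τ x) t ^ 2 + deriv (ψ t) x ^ 2
            + W x * ψ t x ^ 2)) + 2 * (64 * κ * E) := by gcongr
      _ = _ := by ring
  have htop : Lp₀ ≤ 2 * (1 + κ') * Lp + 128 * κ * E :=
    le_of_tendsto_of_tendsto' hLp₀ ((hLp.const_mul (2 * (1 + κ'))).add_const (128 * κ * E)) hpt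
  have hbot : Lm₀ ≤ 2 * (1 + κ') * Lm + 128 * κ * E :=
    le_of_tendsto_of_tendsto' hLm₀ ((hLm.const_mul (2 * (1 + κ'))).add_const (128 * κ * E)) hpt
  linarith

end Forward

end Literature.Analysis.PDE
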